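import Literature.Computability.QuantumComplexity.BoundedIndependenceOracles
import Literature.Computability.QuantumComplexity.AaronsonAmbainis
import Literature.Computability.QuantumComplexity.Symmetrization
import HarnessLib

/-!
# Bounded independence fools low-degree polynomials on the Boolean cube (Zhandry 2012, Thm. 3.1, cube form)

Companion of `BoundedIndependenceOracles.lean` (Zhandry's bounded-independence lemma for oracle circuits and the
tree predicate `IsKWiseIndepFamily`). There the coordinates are oracle strings; the Aaronson–Ambainis side of the
tree (`AaronsonAmbainis.lean`: `boolAvg`, `evalBool`, influences, the acceptance polynomial `acceptPoly` in the
`numOracleBits` relevant bits) works on a cube `{0,1}^N` whose coordinates are LABELLED by strings. This file states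
the first corollary of Zhandry's Thm. 3.1 ("if two weight assignments are `k`-wise equivalent, every quantity that
is a linear combination of the `Pr[H(xᵢ) = rᵢ ∀ i ≤ k]` agrees under both") for that situation:

* `famPoint σ A` — the point of `{0,1}^N` read off the oracle `A` along the labelling `σ : Fin N → strings`
  (`i ↦ [σ i ∈ A]`);
* `evalBool_eq_sum_coeff_mul_ite` — multilinear reduction: on the cube a real polynomial is
  `Σ_d coeff_d · 1[∀ i ∈ supp d, x_i]`; `card_filter_forall_mul` — a subcube of codimension `|D|` has
  `2^{N−|D|}` points (`#· 2^{|D|} = 2^N`); `boolAvg_ite_forall` — its uniform weight is `2^{−|D|}`;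
* **`IsKWiseIndepFamily.sum_evalBool_famPoint`** — for a family `H : K → Set strings` that is `k`-wise
  independent on `S ⊇ range σ` (`σ` injective) and a polynomial `p` of total degree `≤ k`:
  `Σ_key p(famPoint σ (H key)) = |K| · E_{x ∈ {0,1}^N} p(x)`; **`IsKWiseIndepFamily.keyAvg_evalBool_eq_boolAvg`**
  — the same as an equality of averages.

This is the form consumed when a uniformly random completion of the relevant oracle bits is replaced by a member of
an explicit `k`-wise independent family (`Cryptography/ExplicitKWiseHashFamily.lean`) inside an average of a
degree-`≤ k` quantity (acceptance probabilities, query magnitudes of `≤ k/2`-query circuits).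

Sources: M. Zhandry, CRYPTO 2012, Thm. 3.1 and its first corollary [cite: Zhandry2012IBE, Thm. 3.1];
T. Yamakawa, M. Zhandry, FOCS 2022, Lemma 2.5 [cite: YamakawaZhandry2022FOCS, Lemma 2.5]; N. Alon, L. Babai,
A. Itai, J. Algorithms 7 (1986) §2 (k-wise independence) [cite: AlonBabaiItai1986, §2].
-/

noncomputable section

namespace Literature.Computability.QuantumComplexity

open Finset Literature.Computability.Cryptography

variable {N : ℕ}

/-! ### Points of the cube read off an oracle -/

open scoped Classical in
/-- The point of `{0,1}^N` read off the oracle `A` along the string labelling `σ` of the coordinates: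
`famPoint σ A i = [σ i ∈ A]`. [cite: YamakawaZhandry2022FOCS, Lemma 2.5] -/
def famPoint (σ : Fin N → List Bool) (A : Set (List Bool)) : Fin N → Bool := fun i => decide (σ i ∈ A)

open scoped Classical in
/-- `famPoint σ A i = true ↔ σ i ∈ A`. [cite: YamakawaZhandry2022FOCS, Lemma 2.5] -/
theorem famPoint_eq_true_iff (σ : Fin N → List Bool) (A : Set (List Bool)) (i : Fin N) :
    famPoint σ A i = true ↔ σ i ∈ A := by
  simp [famPoint]

/-! ### Multilinear reduction on the cube -/

/-- On the cube a monomial is the indicator of "all its variables are set": `∏_{i ∈ supp d} x_i^{d i} = 1[∀ i ∈ supp d, x_i]`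
(`b^e = b` for `b ∈ {0,1}`, `e ≥ 1`). [cite: Zhandry2012IBE, Thm. 3.1] -/
theorem prod_ite_pow_eq_ite (d : Fin N →₀ ℕ) (x : Fin N → Bool) :
    ∏ i ∈ d.support, (if x i then (1 : ℝ) else 0) ^ d i = if ∀ i ∈ d.support, x i = true then 1 else 0 := by
  have h : ∀ i ∈ d.support, (if x i then (1 : ℝ) else 0) ^ d i = if x i = true then (1 : ℝ) else 0 := by
    intro i hi
    have hd : d i ≠ 0 := Finsupp.mem_support_iff.1 hi
    cases x i <;> simp [hd]
  rw [Finset.prod_congr rfl h, Finset.prod_boole]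
  split_ifs <;> rfl

/-- **Multilinear reduction**: on the cube, `p(x) = Σ_{d ∈ supp p} coeff_d p · 1[∀ i ∈ supp d, x_i]`.
[cite: Zhandry2012IBE, Thm. 3.1] -/
theorem evalBool_eq_sum_coeff_mul_ite (p : MvPolynomial (Fin N) ℝ) (x : Fin N → Bool) :
    evalBool p x = ∑ d ∈ p.support, p.coeff d * if ∀ i ∈ d.support, x i = true then 1 else 0 := by
  rw [evalBool, MvPolynomial.eval_eq]
  exact Finset.sum_congr rfl fun d _ => by rw [prod_ite_pow_eq_ite]

/-! ### Subcubes -/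

/-- **A subcube of codimension `|D|` has `2^{N − |D|}` points**: `#{x | ∀ i ∈ D, x_i} · 2^{|D|} = 2^N` (the
uniform distribution is `k`-wise independent for every `k`). [cite: AlonBabaiItai1986, §2] -/
theorem card_filter_forall_mul (D : Finset (Fin N)) :
    #(univ.filter fun x : Fin N → Bool => ∀ i ∈ D, x i = true) * 2 ^ D.card = 2 ^ N := by
  classical
  induction D using Finset.induction_on with
  | empty => simp [Fintype.card_pi]
  | insert a D ha ih =>
    -- the flip of bit `a` exchanges `{x_a ∧ P}` and `{¬x_a ∧ P}`, which partition `{P}`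
    set σ : (Fin N → Bool) → (Fin N → Bool) := fun v => Function.update v a (!v a) with hσ
    have hinv : Function.Involutive σ := by
      intro v
      simp only [hσ]
      ext i
      by_cases hi : i = a
      · subst hi; simp
      · simp [Function.update_of_ne hi]
    have hP : ∀ v, (∀ i ∈ D, σ v i = true) ↔ ∀ i ∈ D, v i = true := by
      intro v
      refine forall₂_congr fun i hi => ?_
      have hia : i ≠ a := fun h => ha (h ▸ hi)
      simp [hσ, Function.update_of_ne hia]
    have h1 : #(univ.filter fun x : Fin N → Bool => ∀ i ∈ insert a D, x i = true) =
        #(univ.filter fun x : Fin N → Bool => x a = true ∧ ∀ i ∈ D, x i = true) := by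
      congr 1; ext x; simp
    have h2 : #(univ.filter fun x : Fin N → Bool => x a = true ∧ ∀ i ∈ D, x i = true) =
        #(univ.filter fun x : Fin N → Bool => ¬ x a = true ∧ ∀ i ∈ D, x i = true) := by
      refine Finset.card_equiv hinv.toPerm fun v => ?_
      simp only [mem_filter, mem_univ, true_and, Function.Involutive.coe_toPerm, hP]
      simp only [hσ, Function.update_self]
      rcases Bool.eq_false_or_eq_true (v a) with hv | hv <;> simp [hv]
    have h3 := Finset.card_filter_add_card_filter_not
      (s := univ.filter fun x : Fin N → Bool => ∀ i ∈ D, x i = true) (fun x => x a = true)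
    rw [Finset.filter_filter, Finset.filter_filter] at h3
    have h4 : #(univ.filter fun x : Fin N → Bool => (∀ i ∈ D, x i = true) ∧ x a = true) =
        #(univ.filter fun x : Fin N → Bool => x a = true ∧ ∀ i ∈ D, x i = true) := by
      congr 1; ext x; simp [and_comm]
    have h5 : #(univ.filter fun x : Fin N → Bool => (∀ i ∈ D, x i = true) ∧ ¬ x a = true) =
        #(univ.filter fun x : Fin N → Bool => ¬ x a = true ∧ ∀ i ∈ D, x i = true) := by
      congr 1; ext x; simp [and_comm]
    have key : #(univ.filter fun x : Fin N → Bool => ∀ i ∈ insert a D, x i = true) * 2 =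
        #(univ.filter fun x : Fin N → Bool => ∀ i ∈ D, x i = true) := by
      rw [h1]; omega
    rw [Finset.card_insert_of_notMem ha, pow_succ, ← ih, ← key]
    ring

/-- **The uniform weight of a subcube**: `E_x 1[∀ i ∈ D, x_i] = 2^{−|D|}`. [cite: AlonBabaiItai1986, §2] -/
theorem boolAvg_ite_forall (D : Finset (Fin N)) :
    boolAvg (fun x : Fin N → Bool => if ∀ i ∈ D, x i = true then (1 : ℝ) else 0) = 2⁻¹ ^ D.card := by
  classical
  have h := card_filter_forall_mul D
  have h2 : ((#(univ.filter fun x : Fin N → Bool => ∀ i ∈ D, x i = true) : ℕ) : ℝ) = 2 ^ N / 2 ^ D.card := by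
    rw [eq_div_iff (by positivity)]
    exact_mod_cast h
  rw [boolAvg, Finset.sum_boole, h2, div_right_comm, div_self (by positivity), one_div, inv_pow]

/-! ### The averaging identity -/

open scoped Classical in
/-- For a `k`-wise independent family, "all the strings `σ i`, `i ∈ D`, are in `H key`" holds for exactly a
`2^{−|D|}` fraction of the keys (`|D| ≤ k`, `σ` injective into `S`). [cite: Zhandry2012IBE, Thm. 3.1] -/
theorem IsKWiseIndepFamily.sum_ite_forall_famPoint {K : Type*} [Fintype K] {H : K → Set (List Bool)}
    {S : Finset (List Bool)} {k : ℕ} (hH : IsKWiseIndepFamily H S k) {σ : Fin N → List Bool}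
    (hσ : Function.Injective σ) (hσS : ∀ i, σ i ∈ S) (D : Finset (Fin N)) (hD : D.card ≤ k) :
    ∑ key, (if ∀ i ∈ D, famPoint σ (H key) i = true then (1 : ℝ) else 0) = Fintype.card K * 2⁻¹ ^ D.card := by
  set U : Finset (List Bool) := D.map ⟨σ, hσ⟩ with hU
  have hUS : U ⊆ S := by
    intro u hu
    obtain ⟨i, -, rfl⟩ := Finset.mem_map.1 hu
    exact hσS i
  have hUk : U.card ≤ k := by rw [hU, Finset.card_map]; exact hD
  have hK := hH U hUS hUk fun _ => true
  rw [hU, Finset.card_map] at hK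
  have hfilter : (univ.filter fun key => restrictBool (D.map ⟨σ, hσ⟩) (H key) = fun _ => true) =
      univ.filter fun key => ∀ i ∈ D, famPoint σ (H key) i = true := by
    refine Finset.filter_congr fun key _ => ?_
    constructor
    · intro h i hi
      have := congrFun h ⟨σ i, Finset.mem_map_of_mem _ hi⟩
      rw [restrictBool_apply] at this
      rw [famPoint_eq_true_iff]
      exact of_decide_eq_true this
    · intro h
      funext u
      obtain ⟨u, hu⟩ := u
      obtain ⟨i, hi, rfl⟩ := Finset.mem_map.1 hu
      rw [restrictBool_apply]
      exact decide_eq_true ((famPoint_eq_true_iff σ _ i).1 (h i hi))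
  rw [Finset.sum_boole, ← hfilter]
  have hK' : (#(univ.filter fun key => restrictBool (D.map ⟨σ, hσ⟩) (H key) = fun _ => true) : ℝ) *
      2 ^ D.card = Fintype.card K := by exact_mod_cast hK
  rw [← hK', inv_pow, mul_inv_cancel_right₀ (pow_ne_zero _ two_ne_zero)]

open scoped Classical in
/-- **Zhandry's Thm. 3.1, first corollary, cube form.** If `H : K → Set strings` is `k`-wise independent on
`S`, `σ : Fin N → S` is injective and `p` has total degree `≤ k`, then the sum over the keys of `p` at the points
read off `H key` is `|K|` times the uniform average of `p` over `{0,1}^N`. [cite: Zhandry2012IBE, Thm. 3.1]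
[cite: YamakawaZhandry2022FOCS, Lemma 2.5] -/
theorem IsKWiseIndepFamily.sum_evalBool_famPoint {K : Type*} [Fintype K] {H : K → Set (List Bool)}
    {S : Finset (List Bool)} {k : ℕ} (hH : IsKWiseIndepFamily H S k) {σ : Fin N → List Bool}
    (hσ : Function.Injective σ) (hσS : ∀ i, σ i ∈ S) (p : MvPolynomial (Fin N) ℝ) (hp : p.totalDegree ≤ k) :
    ∑ key, evalBool p (famPoint σ (H key)) = Fintype.card K * boolAvg (evalBool p) := by
  -- both sides monomial by monomial
  have hdeg : ∀ d ∈ p.support, d.support.card ≤ k := fun d hd =>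
    (card_support_le_degree d).trans ((MvPolynomial.le_totalDegree hd).trans hp)
  have hR : boolAvg (evalBool p) = ∑ d ∈ p.support, p.coeff d * 2⁻¹ ^ d.support.card := by
    rw [show evalBool p = fun x => ∑ d ∈ p.support, p.coeff d *
        (if ∀ i ∈ d.support, x i = true then (1 : ℝ) else 0) from funext (evalBool_eq_sum_coeff_mul_ite p)]
    rw [boolAvg, Finset.sum_comm, Finset.sum_div]
    refine Finset.sum_congr rfl fun d _ => ?_
    rw [← Finset.mul_sum, mul_div_assoc, ← boolAvg_ite_forall d.support, boolAvg]
  have hL : ∑ key, evalBool p (famPoint σ (H key)) =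
      ∑ d ∈ p.support, p.coeff d * (Fintype.card K * 2⁻¹ ^ d.support.card) := by
    simp_rw [evalBool_eq_sum_coeff_mul_ite]
    rw [Finset.sum_comm]
    refine Finset.sum_congr rfl fun d hd => ?_
    rw [← Finset.mul_sum, hH.sum_ite_forall_famPoint hσ hσS d.support (hdeg d hd)]
  rw [hL, hR, Finset.mul_sum]
  exact Finset.sum_congr rfl fun d _ => by ring

open scoped Classical in
/-- **Average form**: the average over the keys equals the uniform average over the cube. [cite: Zhandry2012IBE, Thm. 3.1]
[cite: YamakawaZhandry2022FOCS, Lemma 2.5] -/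
theorem IsKWiseIndepFamily.keyAvg_evalBool_eq_boolAvg {K : Type*} [Fintype K] [Nonempty K]
    {H : K → Set (List Bool)} {S : Finset (List Bool)} {k : ℕ} (hH : IsKWiseIndepFamily H S k)
    {σ : Fin N → List Bool} (hσ : Function.Injective σ) (hσS : ∀ i, σ i ∈ S) (p : MvPolynomial (Fin N) ℝ)
    (hp : p.totalDegree ≤ k) :
    (∑ key, evalBool p (famPoint σ (H key))) / Fintype.card K = boolAvg (evalBool p) := by
  have hK : (0 : ℝ) < Fintype.card K := by exact_mod_cast Fintype.card_pos
  rw [hH.sum_evalBool_famPoint hσ hσS p hp, mul_div_cancel_left₀ _ hK.ne']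

end Literature.Computability.QuantumComplexity

end
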